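import Summits.BirchSwinnertonDyer.BirchSwinnertonDyer.Theorems.GenusKolyvaginAtTwoShaConsistencyLawFree
import HarnessLib

/-!
# Route `GenusKolyvaginAtTwo` — currency lemmas on the K₄/K₄⁺ frame: the `ℚ`-side and `K`-side `2`-primary exponents and orders agree
# (sequel of `…ShaConsistencyLawFree`; theorems only)

Seat `bsd-line-gk2-p4` g29 (cell `bsd-f1-sign2`), WIDTH-5 attach on route `GenusKolyvaginAtTwo` rev 59.  THEOREMS ONLY (no definition, no
named fact, no `sorry`); standard axioms.  **BSD is NOT proved by this file; K4Neg / K4Pos are NOT proved; no item is closed.**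

On a one-block cell (`#Ш(E_K/K)[2] = 4`) of the pair-sandwich frame with a capitulating class and a twin with `Ш(T/ℚ)[2^∞] = 0`
(the K₄ / K₄⁺ cells), the prequel gives ONE `e ≥ 1` with `Ш(E_K/K)[2^∞] ≃ Ш(E/ℚ)[2^∞] ≃ ℤ/2^e × ℤ/2^e` — unconditionally (no Cassels–Tate
`res`/`cor` adjointness).  Here, in the currency of LEAD-BRIEF-g23-ADDENDUM B.3 / gk2-p5 g36 (4):
* `forall_nsmul_shaPrimary_rat_eq_zero_iff_of_kramerClass_mem_of_frame` — for every `m`: `2^m · Ш(E/ℚ)[2^∞] = 0 ↔ 2^m · Ш(E_K/K)[2^∞] = 0`;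
  so Kolyvagin's B₂ over `ℚ` (exponent `∣ 2^(M₀)`) and the `K`-side upper half U_T/U⁺_T (`#Ш(E_K)[2^∞] ∣ 4^(M₀)`) are ONE inequality `e ≤ M₀`.
* `exists_mem_shaPrimary_rat_addOrderOf_eq_of_kramerClass_mem_of_frame` — `Ш(E/ℚ)[2^∞]` has a class of order EXACTLY `2^e` where
  `#Ш(E_K/K)[2^∞] = #Ш(E/ℚ)[2^∞] = 4^e`; hence «`#Ш(E_K)[2^∞] = 4^(M₀)`» (Kolyvagin exactness over `K`) ⟺ «`#Ш(E/ℚ)[2^∞] = 4^(M₀)`» ⟺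
  «`Ш(E/ℚ)[2^∞]` has a class of order `2^(M₀)`» (the input of gk2-p5's B2Q♭ `kFourPos_shape_of_two_pow_pred_smul_ne_zero`).

References: [McCallumLMS1991] §5; [Kramer1981] Thm. 1; [Kolyvagin1989Izv] Thm. B₂; [Cassels1962ArithmeticIV] §1.
-/

set_option autoImplicit false
set_option linter.dupNamespace false -- `Summit.<P>.<Sub>` repeats `BirchSwinnertonDyer` (D-0017)

noncomputable section

open scoped Classical

namespace Summit.BirchSwinnertonDyer.BirchSwinnertonDyer.Theorems.GenusExact.ShaCores

open WeierstrassCurve NumberField IsDedekindDomain Field AddSubgroup Literature.NumberTheory.EllipticCurves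
  Literature.NumberTheory.GaloisRepresentations

variable (W : WeierstrassCurve ℚ) [W.IsElliptic] (K : Type) [Field K] [NumberField K]

/-! ## §4 Currency lemmas: the `ℚ`-side and `K`-side exponents and orders agree on these cells -/

section Currency

/-- In `ℤ/2^e × ℤ/2^e`: `2^m` kills everything iff `e ≤ m`. [folklore] -/
theorem forall_nsmul_zmod_prod_eq_zero_iff (e m : ℕ) :
    (∀ g : ZMod (2 ^ e) × ZMod (2 ^ e), 2 ^ m • g = 0) ↔ e ≤ m := by
  rw [← Nat.pow_dvd_pow_iff_le_right (by norm_num : 1 < 2)]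
  constructor
  · intro h
    have h1 := congrArg Prod.fst (h (1, 0))
    rw [Prod.smul_fst, Prod.fst_zero, nsmul_eq_mul, mul_one] at h1
    exact (ZMod.natCast_eq_zero_iff _ _).mp h1
  · intro hdvd g
    have hz : ∀ z : ZMod (2 ^ e), 2 ^ m • z = 0 := fun z ↦ by
      rw [nsmul_eq_mul, (ZMod.natCast_eq_zero_iff _ _).mpr hdvd, zero_mul]
    exact Prod.ext (by rw [Prod.smul_fst, Prod.fst_zero]; exact hz g.1) (by rw [Prod.smul_snd, Prod.snd_zero]; exact hz g.2)

/-- In `ℤ/2^e × ℤ/2^e` the element `(1, 0)` has order `2^e`. [folklore] -/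
theorem addOrderOf_one_zero_zmod_prod (e : ℕ) : addOrderOf ((1, 0) : ZMod (2 ^ e) × ZMod (2 ^ e)) = 2 ^ e := by
  haveI : NeZero (2 ^ e) := ⟨pow_ne_zero _ two_ne_zero⟩
  rw [Prod.addOrderOf_mk, addOrderOf_zero, Nat.lcm_one_right, ZMod.addOrderOf_one]

/-- **B₂ over `ℚ` ≡ U_T over `K` on one-block cells with a capitulating class**: for every `m`,
`2^m · Ш(E/ℚ)[2^∞] = 0 ↔ 2^m · Ш(E_K/K)[2^∞] = 0` (both sides `≃ ℤ/2^e × ℤ/2^e` with the same `e`, §3).  So Kolyvagin's `ℚ`-side bound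
(`two_pow_M0_smul_eq_zero_of_mem_sha_rat_signFree`: exponent `∣ 2^(M₀)`) and the `K`-side upper half U_T/U⁺_T (`#Ш(E_K)[2^∞] ∣ 4^(M₀)`)
are ONE inequality `e ≤ M₀` there. [cite: Kolyvagin1989Izv, Thm. B₂] [cite: McCallumLMS1991, §5 Cor. 5.6] [cite: Kramer1981, Thm. 1] -/
theorem forall_nsmul_shaPrimary_rat_eq_zero_iff_of_kramerClass_mem_of_frame (hIQ : IsImaginaryQuadratic K)
    {σ : K ≃ₐ[ℚ] K} (hσ1 : σ ≠ 1)
    (h2tors : ∀ P : (W.baseChange K).toAffine.Point, (2 : ℤ) • P = 0 → P = 0)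
    (hrk : (W.baseChange K).mordellWeilRank ≤ 1)
    (y : (W.baseChange K).toAffine.Point) (M : ℕ)
    (hndiv : ∀ Q : (W.baseChange K).toAffine.Point, ((2 ^ (M + 1) : ℕ) : ℤ) • Q ≠ y)
    (hanti : IsOfFinAddOrder (Affine.Point.map (W' := W) (σ : K →ₐ[ℚ] K) y + y))
    [Finite (AddCommGroup.primaryComponent (↥W.sha) 2)] [Finite (AddCommGroup.primaryComponent (↥(W.baseChange K).sha) 2)]
    (hT0 : ∀ x ∈ AddCommGroup.primaryComponent (↥(W.quadraticTwist (NumberField.discr K : ℚ)).sha) 2, x = 0)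
    (hKr : ∃ η : W.galH1, η ∈ (AddCommGroup.primaryComponent (↥W.sha) 2).map W.sha.subtype ∧ η ≠ 0 ∧ resBaseChange W K η = 0)
    (hX4 : Nat.card (AddSubgroup.torsionBy (↥(W.baseChange K).sha) ((2 : ℕ) : ℤ)) = 4) (m : ℕ) :
    (∀ a ∈ AddCommGroup.primaryComponent (↥W.sha) 2, 2 ^ m • a = 0) ↔
      (∀ x ∈ AddCommGroup.primaryComponent (↥(W.baseChange K).sha) 2, 2 ^ m • x = 0) := by
  obtain ⟨e, -, ⟨eX⟩, ⟨eY⟩, -, -⟩ := exists_addEquiv_shaPrimary_prod_of_kramerClass_mem_of_frame W K hIQ hσ1 h2tors hrk y M hndiv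
    hanti hT0 hKr hX4
  have hXiff : (∀ x ∈ AddCommGroup.primaryComponent (↥(W.baseChange K).sha) 2, 2 ^ m • x = 0) ↔ e ≤ m := by
    rw [← forall_nsmul_zmod_prod_eq_zero_iff e m]
    constructor
    · intro h g
      have h' := h (eX.symm g : AddCommGroup.primaryComponent (↥(W.baseChange K).sha) 2) (eX.symm g).2
      have h'' : 2 ^ m • eX.symm g = 0 := Subtype.ext (by rw [AddSubgroupClass.coe_nsmul, ZeroMemClass.coe_zero]; exact h')
      rw [← eX.apply_symm_apply g, ← map_nsmul, h'', map_zero]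
    · intro h x hx
      have h' := h (eX ⟨x, hx⟩)
      rw [← map_nsmul, eX.map_eq_zero_iff] at h'
      have := congrArg Subtype.val h'
      rwa [AddSubgroupClass.coe_nsmul, ZeroMemClass.coe_zero] at this
  have hYiff : (∀ a ∈ AddCommGroup.primaryComponent (↥W.sha) 2, 2 ^ m • a = 0) ↔ e ≤ m := by
    rw [← forall_nsmul_zmod_prod_eq_zero_iff e m]
    constructor
    · intro h g
      have h' := h (eY.symm g : AddCommGroup.primaryComponent (↥W.sha) 2) (eY.symm g).2
      have h'' : 2 ^ m • eY.symm g = 0 := Subtype.ext (by rw [AddSubgroupClass.coe_nsmul, ZeroMemClass.coe_zero]; exact h')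
      rw [← eY.apply_symm_apply g, ← map_nsmul, h'', map_zero]
    · intro h x hx
      have h' := h (eY ⟨x, hx⟩)
      rw [← map_nsmul, eY.map_eq_zero_iff] at h'
      have := congrArg Subtype.val h'
      rwa [AddSubgroupClass.coe_nsmul, ZeroMemClass.coe_zero] at this
  rw [hYiff, hXiff]

/-- **`Ш(E/ℚ)[2^∞]` has a class of order EXACTLY `2^e`, where `#Ш(E_K/K)[2^∞] = 4^e`**, on one-block cells with a capitulating class
(§3).  With Kolyvagin exactness over `K` (`#Ш(E_K/K)[2^∞] = 4^(M₀)`: U_T′ / U⁺_T′ + L_T / L⁺_T′, or leaf + print via the LEAD's Lossless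
files) this is «`Ш(E/ℚ)[2^∞]` has a class of order `2^(M₀)`» — the `ℚ`-side currency in which gk2-p5's B2Q♭ reads K4Pos/K4Neg.
[cite: McCallumLMS1991, §5] [cite: Kramer1981, Thm. 1] [cite: Cassels1962ArithmeticIV, §1] -/
theorem exists_mem_shaPrimary_rat_addOrderOf_eq_of_kramerClass_mem_of_frame (hIQ : IsImaginaryQuadratic K)
    {σ : K ≃ₐ[ℚ] K} (hσ1 : σ ≠ 1)
    (h2tors : ∀ P : (W.baseChange K).toAffine.Point, (2 : ℤ) • P = 0 → P = 0)
    (hrk : (W.baseChange K).mordellWeilRank ≤ 1)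
    (y : (W.baseChange K).toAffine.Point) (M : ℕ)
    (hndiv : ∀ Q : (W.baseChange K).toAffine.Point, ((2 ^ (M + 1) : ℕ) : ℤ) • Q ≠ y)
    (hanti : IsOfFinAddOrder (Affine.Point.map (W' := W) (σ : K →ₐ[ℚ] K) y + y))
    [Finite (AddCommGroup.primaryComponent (↥W.sha) 2)] [Finite (AddCommGroup.primaryComponent (↥(W.baseChange K).sha) 2)]
    (hT0 : ∀ x ∈ AddCommGroup.primaryComponent (↥(W.quadraticTwist (NumberField.discr K : ℚ)).sha) 2, x = 0)
    (hKr : ∃ η : W.galH1, η ∈ (AddCommGroup.primaryComponent (↥W.sha) 2).map W.sha.subtype ∧ η ≠ 0 ∧ resBaseChange W K η = 0)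
    (hX4 : Nat.card (AddSubgroup.torsionBy (↥(W.baseChange K).sha) ((2 : ℕ) : ℤ)) = 4) :
    ∃ (e : ℕ) (a : ↥W.sha), 1 ≤ e ∧ Nat.card (AddCommGroup.primaryComponent (↥(W.baseChange K).sha) 2) = 4 ^ e ∧
      Nat.card (AddCommGroup.primaryComponent (↥W.sha) 2) = 4 ^ e ∧
      a ∈ AddCommGroup.primaryComponent (↥W.sha) 2 ∧ addOrderOf a = 2 ^ e := by
  obtain ⟨e, he1, -, ⟨eY⟩, hXe, hYe⟩ := exists_addEquiv_shaPrimary_prod_of_kramerClass_mem_of_frame W K hIQ hσ1 h2tors hrk y M hndiv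
    hanti hT0 hKr hX4
  set g : AddCommGroup.primaryComponent (↥W.sha) 2 := eY.symm (1, 0) with hg
  refine ⟨e, (g : ↥W.sha), he1, hXe, hYe, g.2, ?_⟩
  rw [← AddSubgroup.addOrderOf_coe g |>.symm, hg, AddEquiv.addOrderOf_eq, addOrderOf_one_zero_zmod_prod]

end Currency

end Summit.BirchSwinnertonDyer.BirchSwinnertonDyer.Theorems.GenusExact.ShaCores

end
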